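import Literature.MathematicalPhysics.QuantumFieldTheory.Balaban1983to89.B9Eq315QkSingleBondLetter
import Literature.MathematicalPhysics.QuantumFieldTheory.Balaban1983to89.B9Eq315QTowerLipschitzProfile

/-!
# `Balaban1983to89.B9Eq315QkSingleBondTwoBackgroundLetter` — T. Bałaban, *Propagators for lattice gauge theories in a background field*, Commun. Math.
# Phys. **99** (1985) 389–434 [Balaban1985BackgroundPropagators] (3.15)–(3.16) p. 393 *«Q_j(U) … compositions of j one-step averaging operators»*,
# (3.78)–(3.79) p. 406 *«Q(exp(iB)V) = Q(V) + F₂(B) and |F₂(B)B′| ≤ O(1) sup|B| Q″|B′| … The constant O(1) above depends only on d and L»*, (3.84)–(3.86)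
# p. 407, with [Balaban1985Averaging] (124)–(127) pp. 36–37, (140) p. 39, p. 24 *«this definition is local»*: **THE SINGLE-BOND (`ℓ¹`) TWO-BACKGROUND
# LETTER OF THE COMPOSITE AVERAGING AT THE FLAT BASE — `Σ_c ‖((Q_k(U) − Q_k(1))A)(c)‖ ≤ L^d·2d·102(d+1)²L·(Σ_{j<k} ε_j)·∏_{j<k}(L^{−d} + 100d(d+1)α_j)·Σ_b ‖A(b)‖`,
# hence on a spike `‖((Q_k(U) − Q_k(1))δ_b^X)(c)‖ ≤ L^d·2d·102(d+1)²L·(ε⋆∕(1−r))·L^{−kd}·e^{100d(d+1)L^dA}·‖X‖` under the profiles `ε_j ≤ ε⋆r^j`, `Σ_{j<k} α_j ≤ A`;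
# and by local duality THE POINTWISE LETTER OF THE ADJOINT DIFFERENCE `‖((Q_k(U)† − Q_k(1)†)h)(b)‖ ≤ (c₁∕c₀)·k_Δ·2d·M` from `‖h(c)‖ ≤ M` on the zone of `b`,
# which on the chain's diagonal `c₀(L^{n+1})^d = c₁` reads `M_φ′M_φ·L^d·2d·102(d+1)²L·(ε⋆∕(1−r))·e^{100d(d+1)L^dA}·2d·M` — SMALL IN `ε⋆` AND HEIGHT-FREE**

statement-level skeleton of published theorems with citation tags; proofs where landed; nothing here is a claim about the Yang–Mills mass gap

CITATION HEADER (lean-in-tree rule).  Audit cell `pub-balaban`, sub-cell `t4`, BINDER row NE9; filed by NE9 crux-team LEAF PROVER 01 (`b2b-balaban-t4-ne9-formalise-leaf-01`,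
gen 100; ROUTE (J′-G) «bond storey»: the two-background ladder of the bond propagator `G₁,k = Δ_{a,k}⁻¹` at the flat base in LOCAL-LETTER currency, memo
`t4/b2b-balaban-t4-ne9-formalise-leaf-01/g100/ROUTE-JprimeG-BOND-STOREY-g100.md` §B4 «the ONE missing analytic brick is the single-bond two-background letter of Q_k»).
Imports ne9-leaf-03's `B9Eq315QkSingleBondLetter` (the `ℓ¹ → ℓ¹` letter of the composite `sum_norm_Qtower_le`, `prod_level_le`, the spike readings `comp_single_eq`,
`equiv_QkW_apply`, `equiv_QkW_single_eq_zero`; through it `B9Eq315QSingleBondLetter.sum_norm_QtorusLin_le`, `B9Eq315QLocalLetter.QtorusLin_apply_eq_zero_of_support`,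
`B9Eq383QSemiLocal.card_near_le`, ne9-leaf-05's local duality `B9Eq316PenaltyLocalLetter.norm_adjoint_apply_le_local`) and the owner's `B9Eq315QTowerLipschitzProfile`
(through it ne9-leaf-04's one-step modulus `B9Eq315QLipschitz.norm_QtorusLin_sub_flat_le`, `B9Eq315QTowerLipschitz.QtorusLin_apply_eq_of_eq`, the flat tower data
`B9Eq315QTowerFlat.{UlevOf_one, perCfg_UlevOf_one_mem_U1, norm_Wcx_UlevOf_one_sub_one_le}`, `B5Eq172FlatCoercivity.{hU1_one, hreg_one}`).  Sources READ first-hand in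
the held text layers (`paper:balaban1985-cmp99-background-propagators` p. 393 (3.15)–(3.16), p. 406 (3.78)–(3.79), p. 407 (3.84)–(3.86); `paper:balaban1985-cmp98-averaging`
p. 36 (124)–(126), p. 39 (139)–(140), p. 24).  NOTHING of print's proofs beyond the cited identities is used; [folklore] counting, telescoping over the levels and
composition BY NAME of landed one-step letters.

WHY THIS FILE (cell context).  The bond storey's penalty piece `a·(Q_k(U)†Q_k(U) − Q_k(1)†Q_k(1))∘G₁,k(1) = a·[Q_k(U)†(Q_k(U) − Q_k(1)) + (Q_k(U)† − Q_k(1)†)Q_k(1)]∘G₁,k(1)`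
([B9] (3.84)–(3.86)) needs, besides the landed forward letters (`B9Eq315QkLocalLetter`, `B9Eq315QTowerLipschitzProfile.norm_Qtower_sub_flat_apply_le_profile`) and the
landed adjoint letter at ONE background (`B9Eq315QkSingleBondLetter.norm_adjoint_QkW_apply_le_local_sharp`), the pointwise letter of the ADJOINT DIFFERENCE
`(Q_k(U)† − Q_k(1)†)h` at a fine bond `b` WITH the small factor.  By local duality this is the single-bond letter of the forward difference on a spike `δ_b^u`, and the
factor `L^{−(n+1)d}` that cancels the carriers' `c₁∕c₀ = (L^{n+1})^d` is visible ONLY in the `ℓ¹` currency (the sup letter applied to a spike cannot see the small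
average of a delta source).  The `ℓ¹` two-background letter is typed here: at the ONE level where the difference is taken the zone bonds pay the one-step sup modulus
`102(d+1)²L·ε_j` (no `L^{−d}` gain there — whence the constant `L^d` in front), every other level is an `ℓ¹` contraction by `L^{−d}(1 + 100d(d+1)L^dα_i)`.

WHAT IS PROVED (sorry-free; proof lane — 0 `def`; [folklore]).
* §1 (one step, torus `T_{Lm} → T_m`) **`sum_norm_QtorusLin_sub_flat_single_le`** — `Σ_c ‖((Q(U) − Q(1))δ_b^X)(c)‖ ≤ 2d·102(d+1)²L·ε_U·‖X‖` (off the ≤ `2d` zone bonds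
  both values vanish; on the zone the one-step sup modulus); **`sum_norm_QtorusLin_sub_flat_le`** — the `ℓ¹ → ℓ¹` form `Σ_c ‖((Q(U) − Q(1))A)(c)‖ ≤ 2d·102(d+1)²L·ε_U·Σ_b ‖A(b)‖`.
* §2 (tower, any level family against the flat family) **`sum_norm_Qtower_sub_flat_le`** — `Σ_c ‖((Q_n(U) − Q_n(1))A)(c)‖ ≤
  L^d·2d·102(d+1)²L·(Σ_{j<n} ε_j)·∏_{j<n}(L^{−d} + 100d(d+1)α_j)·Σ_b ‖A(b)‖` by the telescoping `Q_{n+1}(U) − Q_{n+1}(1) = [Q_n(U) − Q_n(1)]Q(Ū^n) + Q_n(1)[Q(Ū^n) − Q(1)]`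
  in `ℓ¹` (the flat composite contracts by exactly `L^{−nd}`).
* §3 (one background on `T_{L^k m}`, profiles) **`norm_QkOfU_sub_flat_single_le_heightFree`** — `‖((Q_k(U) − Q_k(1))δ_b^X)(c)‖ ≤ L^d·2d·102(d+1)²L·(ε⋆∕(1−r))·((L^k)^d)⁻¹·
  e^{100d(d+1)L^dA}·‖X‖` under `ε_j ≤ ε⋆r^j` (`j < k`), `Σ_{j<k} α_j ≤ A` — ONE constant for every height.
* §4 (the chain's carriers, `k = n+1`) **`norm_QkW_sub_flat_single_le`** (the two-background spike letter `k_Δ`), **`norm_adjoint_QkW_sub_flat_apply_le_local`**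
  (`‖((Q_k(U)† − Q_k(1)†)h)(b)‖ ≤ (c₁∕c₀)·k_Δ·2d·M` from `‖h(c)‖ ≤ M` on the zone of `b`), **`…_diagonal`** (`c₀(L^{n+1})^d = c₁`: `≤ M_φ′M_φ·L^d·2d·102(d+1)²L·(ε⋆∕(1−r))·
  e^{100d(d+1)L^dA}·2d·M` — no power of the height, linear in `ε⋆`).
HONEST SCOPE.  Counting + telescoping + composition BY NAME; constants crude (`L^d` in front and `L^d` in the exponent — NOT print's `O(1)` of (3.79), which is per unit of the
two-block average `Q″`); the profiles `ε_j ≤ ε⋆r^j`, `Σα_j ≤ A` are DISPLAYED (print's running conditions (3.35)–(3.37)), not derived; flat base only (print's (3.79) is at a general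
`V`); nothing of [B9] Thm 3.1∕3.3∕3.4 asserted; «NE9 ⇐ the named binders»; NE9 NOT PRINTED ∕ NOT PROVED; row WALLED ON A MODEL (O-NE9-1; #5 UNRULED); spine PROVED 0∕9; rung (B)+1 on a
finite T⁴ — NOT infinite volume, NOT mass gap, NOT BetaPertH, NOT Clay.  HONEST DEPENDENCY: continuum YM on T⁴ ⇐ BetaPertH ∧ nine spine estimates (0/9 proved); BetaPertH ⇐ (D1) ∧
(D4) ∧ CAP+tail; G-an2-4 gates asym, D1 and NE2/3/4.  NEW file; nothing modified.  Net new unproved facts: 0.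
-/

noncomputable section

open scoped BigOperators

namespace Literature.MathematicalPhysics.QuantumFieldTheory.Balaban1983to89.B9Eq315QkSingleBondTwoBackgroundLetter

open B4Sect5Torus (TSite)
open B9SectCLatticeCarrier (Bond shift)
open B9Eq311L2Pairing (WL2)
open B11Eq103H1Complex (BondL2K)
open B9Eq319QprimeTorus (fineP blockCoord)
open B7Prop1Explicit (U1 Wcx boxVec)
open B9Eq315QTorus (perCfg cornerSite QtorusLin)
open B9Eq315QTower (towerP Qtower Qtower_zero Qtower_succ UlevOf QkOfU)
open B9Eq316TowerFlatIsOneStep (towerP_eq_fineP_pow siteCast)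
open B9Eq326OperatorTower (QkW)
open B9Eq383QSemiLocal (card_near_le)
open B9Eq315QLocalLetter (QtorusLin_apply_eq_zero_of_support)
open B9Eq315QLipschitz (norm_QtorusLin_sub_flat_le)
open B9Eq315QTowerFlat (UlevOf_one perCfg_UlevOf_one_mem_U1 norm_Wcx_UlevOf_one_sub_one_le)
open B9Eq315QTowerLipschitz (QtorusLin_apply_eq_of_eq)
open B9Eq316PenaltyLocalLetter (norm_adjoint_apply_le_local)
open B9Eq315QSingleBondLetter (sum_norm_QtorusLin_le)
open B9Eq315QkSingleBondLetter (sum_norm_Qtower_le prod_level_le comp_single_eq equiv_QkW_apply equiv_QkW_single_eq_zero)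

/-! ## §1 One step: the `ℓ¹` two-background letter of `Q(U) − Q(1)` -/

section Torus

variable {d : ℕ} (L : ℕ) [NeZero L] (m : Fin d → ℕ) [∀ i, NeZero (m i)] [∀ i, NeZero (fineP L m i)]
  {𝔸 : Type*} [NormedRing 𝔸] [NormedAlgebra ℂ 𝔸] [CompleteSpace 𝔸] [NormOneClass 𝔸] (hL : 1 ≤ L)
  (U : Bond d (fineP L m) → 𝔸ˣ) {α : ℝ} (hα1 : α ≤ 1 / 64)
  (hU1 : ∀ (x : B7Prop1Explicit.Site d) (κ : Fin d), perCfg (fineP L m) U x κ ∈ U1 𝔸)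
  (hreg : ∀ (y : TSite d m) (κ : Fin d) (r : Fin d → Fin L),
    ‖((Wcx L (perCfg (fineP L m) U) (cornerSite L y) κ (boxVec L r) : 𝔸ˣ) : 𝔸) - 1‖ ≤ α)
  {α' : ℝ} (hα1' : α' ≤ 1 / 64)
  (hU1' : ∀ (x : B7Prop1Explicit.Site d) (κ : Fin d), perCfg (fineP L m) (fun _ : Bond d (fineP L m) => (1 : 𝔸ˣ)) x κ ∈ U1 𝔸)
  (hreg' : ∀ (y : TSite d m) (κ : Fin d) (r : Fin d → Fin L),
    ‖((Wcx L (perCfg (fineP L m) (fun _ : Bond d (fineP L m) => (1 : 𝔸ˣ))) (cornerSite L y) κ (boxVec L r) : 𝔸ˣ) : 𝔸) - 1‖ ≤ α')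
  {εU : ℝ} (hεU : 0 ≤ εU) (hUε : ∀ b : Bond d (fineP L m), ‖(U b : 𝔸) - 1‖ ≤ εU)

include hεU hUε in
omit [NeZero L] [∀ i, NeZero (m i)] in
/-- **THE SINGLE-BOND TWO-BACKGROUND LETTER OF THE ONE-STEP AVERAGING, column form**: `Σ_c ‖((Q(U) − Q(1))δ_b^X)(c)‖ ≤ 2d·102(d+1)²L·ε_U·‖X‖` for
`ε_U ≥ sup_b ‖U(b) − 1‖` — off the (at most `2d`, `card_near_le`) coarse bonds `c` with `B(b) ∈ {c₋, c₋ + e_{c.2}}` BOTH values vanish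
(`QtorusLin_apply_eq_zero_of_support`, p. 24 «local»); on the zone the one-step sup modulus `B9Eq315QLipschitz.norm_QtorusLin_sub_flat_le` (print's `F₂` of (3.79)
at `V = 1`, explicit `O(1) = 102(d+1)²L`).  Regularity letters on either side arbitrary (the values do not depend on them). [folklore]
[cite: Balaban1985BackgroundPropagators, (3.15) p.393, (3.78)–(3.79) p.406; Balaban1985Averaging, p.24, (124)–(126) p.36, (140) p.39] -/
theorem sum_norm_QtorusLin_sub_flat_single_le [NeZero L] [DecidableEq (Bond d (fineP L m))] (b : Bond d (fineP L m)) (X : 𝔸) :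
    ∑ c : Bond d m, ‖QtorusLin L m hL U hα1 hU1 hreg (Pi.single b X) c - QtorusLin L m hL (fun _ => 1) hα1' hU1' hreg' (Pi.single b X) c‖ ≤
      2 * d * (102 * (d + 1) ^ 2 * L * εU) * ‖X‖ := by
  classical
  set v : TSite d m := blockCoord L m b.1 with hv
  set R : ℝ := 102 * (d + 1) ^ 2 * L * εU * ‖X‖ with hR
  have hR0 : 0 ≤ R := by positivity
  have hsup : ∀ b', ‖(Pi.single b X : Bond d (fineP L m) → 𝔸) b'‖ ≤ ‖X‖ := fun b' => by
    rw [Pi.single_apply]; split_ifs <;> simp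
  -- the spike vanishes off the block `v`
  have hAv : ∀ b' : Bond d (fineP L m), blockCoord L m b'.1 ≠ v → (Pi.single b X : Bond d (fineP L m) → 𝔸) b' = 0 := fun b' hb' => by
    by_cases h : b' = b
    · exact (hb' (by rw [h])).elim
    · exact Pi.single_eq_of_ne h _
  -- per coarse bond: the one-step modulus on the zone, zero off the zone
  have hc : ∀ c : Bond d m,
      ‖QtorusLin L m hL U hα1 hU1 hreg (Pi.single b X) c - QtorusLin L m hL (fun _ => 1) hα1' hU1' hreg' (Pi.single b X) c‖ ≤
        (if v = c.1 ∨ v = shift c.2 c.1 then R else 0) := by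
    intro c
    by_cases hz : v = c.1 ∨ v = shift c.2 c.1
    · rw [if_pos hz]
      exact (norm_QtorusLin_sub_flat_le L m hL U hα1 hU1 hreg hα1' hU1' hreg' hεU hUε (Pi.single b X) hsup c).trans (le_of_eq hR.symm)
    · rw [if_neg hz]
      simp only [not_or] at hz
      rw [QtorusLin_apply_eq_zero_of_support L m hL U hα1 hU1 hreg v _ hAv c (Ne.symm hz.1) (Ne.symm hz.2),
        QtorusLin_apply_eq_zero_of_support L m hL (fun _ => 1) hα1' hU1' hreg' v _ hAv c (Ne.symm hz.1) (Ne.symm hz.2), sub_zero, norm_zero]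
  have hzone : ∑ c : Bond d m, (if v = c.1 ∨ v = shift c.2 c.1 then R else 0) ≤ 2 * d * R := by
    rw [← Finset.sum_filter, Finset.sum_const, nsmul_eq_mul]
    refine mul_le_mul_of_nonneg_right ?_ hR0
    exact_mod_cast card_near_le m v
  calc ∑ c : Bond d m, ‖QtorusLin L m hL U hα1 hU1 hreg (Pi.single b X) c - QtorusLin L m hL (fun _ => 1) hα1' hU1' hreg' (Pi.single b X) c‖
      ≤ ∑ c : Bond d m, (if v = c.1 ∨ v = shift c.2 c.1 then R else 0) := Finset.sum_le_sum fun c _ => hc c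
    _ ≤ 2 * d * R := hzone
    _ = 2 * d * (102 * (d + 1) ^ 2 * L * εU) * ‖X‖ := by rw [hR]; ring

include hεU hUε in
omit [NeZero L] [∀ i, NeZero (m i)] in
/-- **THE `ℓ¹ → ℓ¹` TWO-BACKGROUND LETTER OF THE ONE-STEP AVERAGING**: `Σ_c ‖((Q(U) − Q(1))A)(c)‖ ≤ 2d·102(d+1)²L·ε_U·Σ_b ‖A(b)‖` — linearity over the spikes
`A = Σ_b δ_b^{A(b)}` and the column letter `sum_norm_QtorusLin_sub_flat_single_le`.  (No `L^{−d}` gain at the step where the difference is taken: the zone bonds pay the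
sup modulus once each.) [folklore] [cite: Balaban1985BackgroundPropagators, (3.15) p.393, (3.78)–(3.79) p.406; Balaban1985Averaging, p.24, (124)–(126) p.36, (140) p.39] -/
theorem sum_norm_QtorusLin_sub_flat_le [NeZero L] (A : Bond d (fineP L m) → 𝔸) :
    ∑ c : Bond d m, ‖QtorusLin L m hL U hα1 hU1 hreg A c - QtorusLin L m hL (fun _ => 1) hα1' hU1' hreg' A c‖ ≤
      2 * d * (102 * (d + 1) ^ 2 * L * εU) * ∑ b, ‖A b‖ := by
  classical
  set T := QtorusLin L m hL U hα1 hU1 hreg - QtorusLin L m hL (fun _ => 1) hα1' hU1' hreg' with hT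
  have hTa : ∀ (B : Bond d (fineP L m) → 𝔸) (c : Bond d m),
      T B c = QtorusLin L m hL U hα1 hU1 hreg B c - QtorusLin L m hL (fun _ => 1) hα1' hU1' hreg' B c := fun B c => rfl
  have hA : T A = ∑ b, T (Pi.single b (A b)) := by
    rw [← map_sum, Finset.univ_sum_single]
  calc ∑ c : Bond d m, ‖QtorusLin L m hL U hα1 hU1 hreg A c - QtorusLin L m hL (fun _ => 1) hα1' hU1' hreg' A c‖
      = ∑ c : Bond d m, ‖∑ b, T (Pi.single b (A b)) c‖ := by
        refine Finset.sum_congr rfl fun c _ => ?_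
        rw [← hTa, hA, Finset.sum_apply]
    _ ≤ ∑ c : Bond d m, ∑ b, ‖T (Pi.single b (A b)) c‖ := Finset.sum_le_sum fun c _ => norm_sum_le _ _
    _ = ∑ b, ∑ c : Bond d m, ‖T (Pi.single b (A b)) c‖ := Finset.sum_comm
    _ ≤ ∑ b, 2 * d * (102 * (d + 1) ^ 2 * L * εU) * ‖A b‖ :=
        Finset.sum_le_sum fun b _ => by
          simp only [hTa]
          exact sum_norm_QtorusLin_sub_flat_single_le L m hL U hα1 hU1 hreg hα1' hU1' hreg' hεU hUε b (A b)
    _ = 2 * d * (102 * (d + 1) ^ 2 * L * εU) * ∑ b, ‖A b‖ := by rw [← Finset.mul_sum]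

end Torus

/-! ## §2 The tower: the `ℓ¹` two-background letter of the composite `Q_n(U) − Q_n(1)`, by telescoping over the levels -/

section TowerQ

variable {d : ℕ} (L : ℕ) [NeZero L] (m : Fin d → ℕ) [∀ i, NeZero (m i)]
  {𝔸 : Type*} [NormedRing 𝔸] [NormedAlgebra ℂ 𝔸] [CompleteSpace 𝔸] [NormOneClass 𝔸] (hL : 1 ≤ L) (k : ℕ) (U : Bond d (towerP L m k) → 𝔸ˣ)
  (α : ℕ → ℝ) (hα0 : ∀ j, 0 ≤ α j) (hα1 : ∀ j, α j ≤ 1 / 64)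
  (hU1 : ∀ (j : ℕ) (x : B7Prop1Explicit.Site d) (κ : Fin d), perCfg (towerP L m (j + 1)) (UlevOf L m k U j) x κ ∈ U1 𝔸)
  (hreg : ∀ (j : ℕ) (y : TSite d (towerP L m j)) (κ : Fin d) (r : Fin d → Fin L),
    ‖((Wcx L (perCfg (towerP L m (j + 1)) (UlevOf L m k U j)) (cornerSite L y) κ (boxVec L r) : 𝔸ˣ) : 𝔸) - 1‖ ≤ α j)
  (εU : ℕ → ℝ) (hεU : ∀ j, 0 ≤ εU j) (hUε : ∀ (j : ℕ) (b : Bond d (towerP L m (j + 1))), ‖(UlevOf L m k U j b : 𝔸) - 1‖ ≤ εU j)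

include hα0 hεU hUε in
/-- **THE `ℓ¹` TWO-BACKGROUND LETTER OF THE COMPOSITE AVERAGING AT THE FLAT BASE**: if the level average `Ū^j` composed at depth `j` has bond variables `ε_j`-close
to `1` and `α_j`-regular block loops (`α_j ≥ 0`), then
`Σ_c ‖(Q_n(U)A)(c) − (Q_n(1)A)(c)‖ ≤ L^d·2d·102(d+1)²L·(Σ_{j<n} ε_j)·∏_{j<n}(L^{−d} + 100d(d+1)α_j)·Σ_b ‖A(b)‖` — the telescoping
`Q_{n+1}(U) − Q_{n+1}(1) = [Q_n(U) − Q_n(1)]Q(Ū^n) + Q_n(1)[Q(Ū^n) − Q(1)]` (`Qtower_succ`, finest factor first) in the `ℓ¹` currency: the first term by induction and the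
one-step `ℓ¹ → ℓ¹` letter `B9Eq315QSingleBondLetter.sum_norm_QtorusLin_le` (factor `L^{−d} + 100d(d+1)α_n`), the second by the flat composite's exact contraction `L^{−nd}`
(`B9Eq315QkSingleBondLetter.sum_norm_Qtower_le` at `α ≡ 0`) and §1 (`2d·102(d+1)²L·ε_n`); `L^{−nd} ≤ L^d·∏_{j≤n}(L^{−d} + 100d(d+1)α_j)` absorbs the level where the
difference is taken.  The number of levels enters ONLY through `Σ_j ε_j` and the level product. [folklore]
[cite: Balaban1985BackgroundPropagators, (3.15)–(3.16) p.393, (3.35)–(3.37) p.396, (3.78)–(3.79) p.406; Balaban1985Averaging, (124)–(127) pp.36–37, (140) p.39, p.24] -/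
theorem sum_norm_Qtower_sub_flat_le : ∀ (n : ℕ) (A : Bond d (towerP L m n) → 𝔸),
    ∑ c : Bond d m, ‖Qtower L m hL (UlevOf L m k U) α hα1 hU1 hreg n A c -
      Qtower L m hL (UlevOf L m k (fun _ : Bond d (towerP L m k) => (1 : 𝔸ˣ))) (fun _ => 0) (fun _ => by norm_num)
        (perCfg_UlevOf_one_mem_U1 L m k) (norm_Wcx_UlevOf_one_sub_one_le L m k (fun _ => 0) (fun _ => le_rfl)) n A c‖ ≤
      (L : ℝ) ^ d * (2 * d * (102 * (d + 1) ^ 2 * L)) * (∑ j ∈ Finset.range n, εU j) *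
        (∏ j ∈ Finset.range n, (((L : ℝ) ^ d)⁻¹ + 100 * d * (d + 1) * α j)) * ∑ b, ‖A b‖
  | 0, A => by simp
  | n + 1, A => by
    have hLpos : (0 : ℝ) < L := by exact_mod_cast hL
    have hLd : (0 : ℝ) < (L : ℝ) ^ d := by positivity
    set C : ℝ := 2 * d * (102 * (d + 1) ^ 2 * L) with hC
    have hC0 : 0 ≤ C := by positivity
    have hPn0 : 0 ≤ ∏ j ∈ Finset.range n, (((L : ℝ) ^ d)⁻¹ + 100 * d * (d + 1) * α j) :=
      Finset.prod_nonneg fun j _ => by have := hα0 j; positivity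
    have hSn : 0 ≤ ∑ j ∈ Finset.range n, εU j := Finset.sum_nonneg fun j _ => hεU j
    have hSA : 0 ≤ ∑ b, ‖A b‖ := Finset.sum_nonneg fun b _ => norm_nonneg _
    -- the level product dominates the flat contraction: `(L^{-d})^{n+1} ≤ ∏_{j≤n}(L^{-d} + 100d(d+1)α_j)`
    have hPlow : (((L : ℝ) ^ d)⁻¹) ^ (n + 1) ≤ ∏ j ∈ Finset.range (n + 1), (((L : ℝ) ^ d)⁻¹ + 100 * d * (d + 1) * α j) := by
      calc (((L : ℝ) ^ d)⁻¹) ^ (n + 1) = ∏ _j ∈ Finset.range (n + 1), ((L : ℝ) ^ d)⁻¹ := by rw [Finset.prod_const, Finset.card_range]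
        _ ≤ ∏ j ∈ Finset.range (n + 1), (((L : ℝ) ^ d)⁻¹ + 100 * d * (d + 1) * α j) :=
          Finset.prod_le_prod (fun j _ => by positivity) fun j _ => le_add_of_nonneg_right (by have := hα0 j; positivity)
    have hkey : (((L : ℝ) ^ d)⁻¹) ^ n ≤ (L : ℝ) ^ d * ∏ j ∈ Finset.range (n + 1), (((L : ℝ) ^ d)⁻¹ + 100 * d * (d + 1) * α j) := by
      have h1 : (L : ℝ) ^ d * (((L : ℝ) ^ d)⁻¹) ^ (n + 1) = (((L : ℝ) ^ d)⁻¹) ^ n := by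
        rw [pow_succ]; field_simp
      rw [← h1]
      exact mul_le_mul_of_nonneg_left hPlow hLd.le
    -- `x` = the level-`n` image at `U`, `y` = at the flat background (tower spelling)
    set x : Bond d (towerP L m n) → 𝔸 := QtorusLin L (towerP L m n) hL (UlevOf L m k U n) (hα1 n) (hU1 n) (hreg n) A with hx
    set y : Bond d (towerP L m n) → 𝔸 := QtorusLin L (towerP L m n) hL (UlevOf L m k (fun _ : Bond d (towerP L m k) => (1 : 𝔸ˣ)) n)
      (by norm_num) (perCfg_UlevOf_one_mem_U1 L m k n) (norm_Wcx_UlevOf_one_sub_one_le L m k (fun _ => 0) (fun _ => le_rfl) n) A with hy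
    -- the flat factor at level `n` IS the one-step flat averaging (its background is `1` by `UlevOf_one`)
    have hy' : ∀ b, y b = QtorusLin L (towerP L m n) hL (fun _ : Bond d (fineP L (towerP L m n)) => (1 : 𝔸ˣ)) (show (0 : ℝ) ≤ 1 / 64 by norm_num)
        (B5Eq172FlatCoercivity.hU1_one L (towerP L m n)) (B5Eq172FlatCoercivity.hreg_one L (towerP L m n)) A b :=
      QtorusLin_apply_eq_of_eq L (towerP L m n) hL _ _ _ _ (UlevOf_one L m k n) _ _ _ A
    -- (i) the `ℓ¹` mass of `x`
    have hxl1 : ∑ b', ‖x b'‖ ≤ (((L : ℝ) ^ d)⁻¹ + 100 * d * (d + 1) * α n) * ∑ b, ‖A b‖ :=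
      sum_norm_QtorusLin_le L (towerP L m n) hL (UlevOf L m k U n) (hα1 n) (hU1 n) (hreg n) A
    -- (ii) the `ℓ¹` mass of `x − y` (§1 at level `n`)
    have hxyl1 : ∑ b', ‖(x - y) b'‖ ≤ C * εU n * ∑ b, ‖A b‖ := by
      have h := sum_norm_QtorusLin_sub_flat_le L (towerP L m n) hL (UlevOf L m k U n) (hα1 n) (hU1 n) (hreg n)
        (show (0 : ℝ) ≤ 1 / 64 by norm_num) (B5Eq172FlatCoercivity.hU1_one L (towerP L m n)) (B5Eq172FlatCoercivity.hreg_one L (towerP L m n))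
        (hεU n) (fun b' => hUε n b') A
      calc ∑ b', ‖(x - y) b'‖
          = ∑ b', ‖x b' - QtorusLin L (towerP L m n) hL (fun _ : Bond d (fineP L (towerP L m n)) => (1 : 𝔸ˣ)) (show (0 : ℝ) ≤ 1 / 64 by norm_num)
              (B5Eq172FlatCoercivity.hU1_one L (towerP L m n)) (B5Eq172FlatCoercivity.hreg_one L (towerP L m n)) A b'‖ :=
            Finset.sum_congr rfl fun b' _ => by rw [Pi.sub_apply, hy' b']
        _ ≤ 2 * d * (102 * (d + 1) ^ 2 * L * εU n) * ∑ b, ‖A b‖ := h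
        _ = C * εU n * ∑ b, ‖A b‖ := by rw [hC]; ring
    -- (iii) the induction hypothesis at `x`
    have ih := sum_norm_Qtower_sub_flat_le n x
    -- (iv) the flat composite contracts `x − y` by exactly `L^{-nd}`
    have hflat : ∑ c : Bond d m, ‖Qtower L m hL (UlevOf L m k (fun _ : Bond d (towerP L m k) => (1 : 𝔸ˣ))) (fun _ => 0) (fun _ => by norm_num)
        (perCfg_UlevOf_one_mem_U1 L m k) (norm_Wcx_UlevOf_one_sub_one_le L m k (fun _ => 0) (fun _ => le_rfl)) n (x - y) c‖ ≤
        (((L : ℝ) ^ d)⁻¹) ^ n * (C * εU n * ∑ b, ‖A b‖) := by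
      have h := sum_norm_Qtower_le L m hL (UlevOf L m k (fun _ : Bond d (towerP L m k) => (1 : 𝔸ˣ))) (fun _ => 0) (fun _ => le_rfl)
        (fun _ => by norm_num) (perCfg_UlevOf_one_mem_U1 L m k) (norm_Wcx_UlevOf_one_sub_one_le L m k (fun _ => 0) (fun _ => le_rfl)) n (x - y)
      simp only [mul_zero, add_zero, Finset.prod_const, Finset.card_range] at h
      exact h.trans (mul_le_mul_of_nonneg_left hxyl1 (by positivity))
    -- the telescoping split, per coarse bond
    have hsplit : ∀ c : Bond d m,
        Qtower L m hL (UlevOf L m k U) α hα1 hU1 hreg n x c -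
          Qtower L m hL (UlevOf L m k (fun _ : Bond d (towerP L m k) => (1 : 𝔸ˣ))) (fun _ => 0) (fun _ => by norm_num)
            (perCfg_UlevOf_one_mem_U1 L m k) (norm_Wcx_UlevOf_one_sub_one_le L m k (fun _ => 0) (fun _ => le_rfl)) n y c =
        (Qtower L m hL (UlevOf L m k U) α hα1 hU1 hreg n x c -
          Qtower L m hL (UlevOf L m k (fun _ : Bond d (towerP L m k) => (1 : 𝔸ˣ))) (fun _ => 0) (fun _ => by norm_num)
            (perCfg_UlevOf_one_mem_U1 L m k) (norm_Wcx_UlevOf_one_sub_one_le L m k (fun _ => 0) (fun _ => le_rfl)) n x c) +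
        Qtower L m hL (UlevOf L m k (fun _ : Bond d (towerP L m k) => (1 : 𝔸ˣ))) (fun _ => 0) (fun _ => by norm_num)
            (perCfg_UlevOf_one_mem_U1 L m k) (norm_Wcx_UlevOf_one_sub_one_le L m k (fun _ => 0) (fun _ => le_rfl)) n (x - y) c := by
      intro c; rw [map_sub, Pi.sub_apply]; abel
    calc ∑ c : Bond d m, ‖Qtower L m hL (UlevOf L m k U) α hα1 hU1 hreg (n + 1) A c -
          Qtower L m hL (UlevOf L m k (fun _ : Bond d (towerP L m k) => (1 : 𝔸ˣ))) (fun _ => 0) (fun _ => by norm_num)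
            (perCfg_UlevOf_one_mem_U1 L m k) (norm_Wcx_UlevOf_one_sub_one_le L m k (fun _ => 0) (fun _ => le_rfl)) (n + 1) A c‖
        = ∑ c : Bond d m, ‖Qtower L m hL (UlevOf L m k U) α hα1 hU1 hreg n x c -
          Qtower L m hL (UlevOf L m k (fun _ : Bond d (towerP L m k) => (1 : 𝔸ˣ))) (fun _ => 0) (fun _ => by norm_num)
            (perCfg_UlevOf_one_mem_U1 L m k) (norm_Wcx_UlevOf_one_sub_one_le L m k (fun _ => 0) (fun _ => le_rfl)) n y c‖ := rfl
      _ ≤ ∑ c : Bond d m, (‖Qtower L m hL (UlevOf L m k U) α hα1 hU1 hreg n x c -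
          Qtower L m hL (UlevOf L m k (fun _ : Bond d (towerP L m k) => (1 : 𝔸ˣ))) (fun _ => 0) (fun _ => by norm_num)
            (perCfg_UlevOf_one_mem_U1 L m k) (norm_Wcx_UlevOf_one_sub_one_le L m k (fun _ => 0) (fun _ => le_rfl)) n x c‖ +
          ‖Qtower L m hL (UlevOf L m k (fun _ : Bond d (towerP L m k) => (1 : 𝔸ˣ))) (fun _ => 0) (fun _ => by norm_num)
            (perCfg_UlevOf_one_mem_U1 L m k) (norm_Wcx_UlevOf_one_sub_one_le L m k (fun _ => 0) (fun _ => le_rfl)) n (x - y) c‖) :=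
          Finset.sum_le_sum fun c _ => by rw [hsplit c]; exact norm_add_le _ _
      _ = (∑ c : Bond d m, ‖Qtower L m hL (UlevOf L m k U) α hα1 hU1 hreg n x c -
          Qtower L m hL (UlevOf L m k (fun _ : Bond d (towerP L m k) => (1 : 𝔸ˣ))) (fun _ => 0) (fun _ => by norm_num)
            (perCfg_UlevOf_one_mem_U1 L m k) (norm_Wcx_UlevOf_one_sub_one_le L m k (fun _ => 0) (fun _ => le_rfl)) n x c‖) +
          ∑ c : Bond d m, ‖Qtower L m hL (UlevOf L m k (fun _ : Bond d (towerP L m k) => (1 : 𝔸ˣ))) (fun _ => 0) (fun _ => by norm_num)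
            (perCfg_UlevOf_one_mem_U1 L m k) (norm_Wcx_UlevOf_one_sub_one_le L m k (fun _ => 0) (fun _ => le_rfl)) n (x - y) c‖ :=
          Finset.sum_add_distrib
      _ ≤ (L : ℝ) ^ d * C * (∑ j ∈ Finset.range n, εU j) * (∏ j ∈ Finset.range n, (((L : ℝ) ^ d)⁻¹ + 100 * d * (d + 1) * α j)) * ∑ b', ‖x b'‖ +
          (((L : ℝ) ^ d)⁻¹) ^ n * (C * εU n * ∑ b, ‖A b‖) := add_le_add ih hflat
      _ ≤ (L : ℝ) ^ d * C * (∑ j ∈ Finset.range n, εU j) * (∏ j ∈ Finset.range n, (((L : ℝ) ^ d)⁻¹ + 100 * d * (d + 1) * α j)) *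
            ((((L : ℝ) ^ d)⁻¹ + 100 * d * (d + 1) * α n) * ∑ b, ‖A b‖) +
          ((L : ℝ) ^ d * ∏ j ∈ Finset.range (n + 1), (((L : ℝ) ^ d)⁻¹ + 100 * d * (d + 1) * α j)) * (C * εU n * ∑ b, ‖A b‖) := by
          have h0 : 0 ≤ C * εU n * ∑ b, ‖A b‖ := by have := hεU n; positivity
          exact add_le_add (mul_le_mul_of_nonneg_left hxl1 (by positivity)) (mul_le_mul_of_nonneg_right hkey h0)
      _ = (L : ℝ) ^ d * C * (∑ j ∈ Finset.range (n + 1), εU j) *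
            (∏ j ∈ Finset.range (n + 1), (((L : ℝ) ^ d)⁻¹ + 100 * d * (d + 1) * α j)) * ∑ b, ‖A b‖ := by
          rw [Finset.sum_range_succ, Finset.prod_range_succ]; ring

end TowerQ

/-! ## §3 One background on `T_{L^k m}` under profiles: the height-free single-bond form -/

section OneBackground

/-- `Σ_{j<n} s·r^j ≤ s∕(1−r)` for `0 ≤ r < 1`, `0 ≤ s`. [folklore] -/
private theorem sum_geometric_le (s r : ℝ) (hs : 0 ≤ s) (hr0 : 0 ≤ r) (hr1 : r < 1) (n : ℕ) :
    ∑ j ∈ Finset.range n, s * r ^ j ≤ s / (1 - r) := by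
  rw [← Finset.mul_sum, div_eq_mul_one_div]
  refine mul_le_mul_of_nonneg_left ?_ hs
  have h := geom_sum_Ico_le_of_lt_one (m := 0) (n := n) hr0 hr1
  rw [pow_zero] at h
  rwa [Finset.range_eq_Ico]

variable {d : ℕ} (L : ℕ) [NeZero L] (m : Fin d → ℕ) [∀ i, NeZero (m i)]
  {𝔸 : Type*} [NormedRing 𝔸] [NormedAlgebra ℂ 𝔸] [CompleteSpace 𝔸] [NormOneClass 𝔸] (hL : 1 ≤ L) (k : ℕ) (U : Bond d (towerP L m k) → 𝔸ˣ)
  (α : ℕ → ℝ) (hα0 : ∀ j, 0 ≤ α j) (hα1 : ∀ j, α j ≤ 1 / 64)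
  (hU1 : ∀ (j : ℕ) (x : B7Prop1Explicit.Site d) (κ : Fin d), perCfg (towerP L m (j + 1)) (UlevOf L m k U j) x κ ∈ U1 𝔸)
  (hreg : ∀ (j : ℕ) (y : TSite d (towerP L m j)) (κ : Fin d) (r : Fin d → Fin L),
    ‖((Wcx L (perCfg (towerP L m (j + 1)) (UlevOf L m k U j)) (cornerSite L y) κ (boxVec L r) : 𝔸ˣ) : 𝔸) - 1‖ ≤ α j)
  (εU : ℕ → ℝ) (hεU : ∀ j, 0 ≤ εU j) (hUε : ∀ (j : ℕ) (b : Bond d (towerP L m (j + 1))), ‖(UlevOf L m k U j b : 𝔸) - 1‖ ≤ εU j)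
  {r εs : ℝ} (hr0 : 0 ≤ r) (hr1 : r < 1) (hεs : 0 ≤ εs) (hεg : ∀ j < k, εU j ≤ εs * r ^ j)

include hα0 hεU hUε hr0 hr1 hεs hεg in
/-- **`Q_k(U) − Q_k(1)` ON A SPIKE, HEIGHT-FREE**: `ε_j ≤ ε⋆r^j` (`j < k`, `0 ≤ r < 1`) and `Σ_{j<k} α_j ≤ A` ⟹
`‖((Q_k(U) − Q_k(1))δ_b^X)(c)‖ ≤ L^d·2d·102(d+1)²L·(ε⋆∕(1−r))·((L^k)^d)⁻¹·e^{100d(d+1)L^dA}·‖X‖` — one term of §2's column sum (`Σ_{b′}‖δ_b^X(b′)‖ = ‖X‖`), the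
level product by `B9Eq315QkSingleBondLetter.prod_level_le`, the closeness sum by the geometric series.  ONE constant for every number of levels, LINEAR in `ε⋆`.
[folklore] [cite: Balaban1985BackgroundPropagators, (3.15)–(3.16) p.393, (3.35)–(3.37) p.396, (3.78)–(3.79) p.406; Balaban1985Averaging, (124)–(127) pp.36–37, p.24] -/
theorem norm_QkOfU_sub_flat_single_le_heightFree [DecidableEq (Bond d (towerP L m k))] {A : ℝ} (hA : ∑ j ∈ Finset.range k, α j ≤ A)
    (b : Bond d (towerP L m k)) (X : 𝔸) (c : Bond d m) :
    ‖QkOfU L m hL k U α hα1 hU1 hreg (Pi.single b X) c -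
        QkOfU L m hL k (fun _ : Bond d (towerP L m k) => (1 : 𝔸ˣ)) (fun _ => 0) (fun _ => by norm_num)
          (perCfg_UlevOf_one_mem_U1 L m k) (norm_Wcx_UlevOf_one_sub_one_le L m k (fun _ => 0) (fun _ => le_rfl)) (Pi.single b X) c‖ ≤
      (L : ℝ) ^ d * (2 * d * (102 * (d + 1) ^ 2 * L)) * (εs / (1 - r)) *
        ((((L : ℝ) ^ k) ^ d)⁻¹ * Real.exp (100 * d * (d + 1) * (L : ℝ) ^ d * A)) * ‖X‖ := by
  have hLpos : (0 : ℝ) < L := by exact_mod_cast hL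
  have hsum : ∑ b', ‖(Pi.single b X : Bond d (towerP L m k) → 𝔸) b'‖ = ‖X‖ := by
    rw [Finset.sum_eq_single b (fun b' _ hb' => by rw [Pi.single_eq_of_ne hb', norm_zero]) (fun h => (h (Finset.mem_univ _)).elim),
      Pi.single_eq_same]
  have h := sum_norm_Qtower_sub_flat_le L m hL k U α hα0 hα1 hU1 hreg εU hεU hUε k (Pi.single b X)
  rw [hsum] at h
  have h1 : ‖QkOfU L m hL k U α hα1 hU1 hreg (Pi.single b X) c -
        QkOfU L m hL k (fun _ : Bond d (towerP L m k) => (1 : 𝔸ˣ)) (fun _ => 0) (fun _ => by norm_num)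
          (perCfg_UlevOf_one_mem_U1 L m k) (norm_Wcx_UlevOf_one_sub_one_le L m k (fun _ => 0) (fun _ => le_rfl)) (Pi.single b X) c‖ ≤
      (L : ℝ) ^ d * (2 * d * (102 * (d + 1) ^ 2 * L)) * (∑ j ∈ Finset.range k, εU j) *
        (∏ j ∈ Finset.range k, (((L : ℝ) ^ d)⁻¹ + 100 * d * (d + 1) * α j)) * ‖X‖ :=
    (Finset.single_le_sum (f := fun c => ‖QkOfU L m hL k U α hα1 hU1 hreg (Pi.single b X) c -
        QkOfU L m hL k (fun _ : Bond d (towerP L m k) => (1 : 𝔸ˣ)) (fun _ => 0) (fun _ => by norm_num)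
          (perCfg_UlevOf_one_mem_U1 L m k) (norm_Wcx_UlevOf_one_sub_one_le L m k (fun _ => 0) (fun _ => le_rfl)) (Pi.single b X) c‖)
      (fun c _ => norm_nonneg _) (Finset.mem_univ c)).trans h
  have hS : ∑ j ∈ Finset.range k, εU j ≤ εs / (1 - r) :=
    (Finset.sum_le_sum fun j hj => hεg j (Finset.mem_range.mp hj)).trans (sum_geometric_le εs r hεs hr0 hr1 k)
  have hP : ∏ j ∈ Finset.range k, (((L : ℝ) ^ d)⁻¹ + 100 * d * (d + 1) * α j) ≤
      (((L : ℝ) ^ k) ^ d)⁻¹ * Real.exp (100 * d * (d + 1) * (L : ℝ) ^ d * A) := by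
    have h2 := prod_level_le (d := d) L hL α hα0 k
    have h3 : Real.exp (100 * d * (d + 1) * (L : ℝ) ^ d * ∑ j ∈ Finset.range k, α j) ≤ Real.exp (100 * d * (d + 1) * (L : ℝ) ^ d * A) :=
      Real.exp_le_exp.mpr (mul_le_mul_of_nonneg_left hA (by positivity))
    have hpow : (((L : ℝ) ^ d)⁻¹) ^ k = (((L : ℝ) ^ k) ^ d)⁻¹ := by rw [inv_pow, ← pow_mul, ← pow_mul, mul_comm]
    rw [← hpow]
    exact h2.trans (mul_le_mul_of_nonneg_left h3 (by positivity))
  have hP0 : 0 ≤ ∏ j ∈ Finset.range k, (((L : ℝ) ^ d)⁻¹ + 100 * d * (d + 1) * α j) :=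
    Finset.prod_nonneg fun j _ => by have := hα0 j; positivity
  have hS0 : 0 ≤ ∑ j ∈ Finset.range k, εU j := Finset.sum_nonneg fun j _ => hεU j
  calc _ ≤ (L : ℝ) ^ d * (2 * d * (102 * (d + 1) ^ 2 * L)) * (∑ j ∈ Finset.range k, εU j) *
        (∏ j ∈ Finset.range k, (((L : ℝ) ^ d)⁻¹ + 100 * d * (d + 1) * α j)) * ‖X‖ := h1
    _ ≤ (L : ℝ) ^ d * (2 * d * (102 * (d + 1) ^ 2 * L)) * (εs / (1 - r)) *
        ((((L : ℝ) ^ k) ^ d)⁻¹ * Real.exp (100 * d * (d + 1) * (L : ℝ) ^ d * A)) * ‖X‖ := by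
        gcongr

end OneBackground

/-! ## §4 On the chain's carriers at `k = n+1` levels: the two-background spike letter `k_Δ` and the adjoint difference from local values -/

section Carrier

variable {d : ℕ} (L : ℕ) [NeZero L] (m : Fin d → ℕ) [∀ i, NeZero (m i)] (n : ℕ)
  {𝔸 : Type*} [NormedRing 𝔸] [NormedAlgebra ℂ 𝔸] [CompleteSpace 𝔸] [NormOneClass 𝔸]
  {W : Type*} [NormedAddCommGroup W] [InnerProductSpace ℂ W] (φ : W ≃ₗ[ℂ] 𝔸) {c₀ c₁ : ℝ} [Fact (0 < c₀)] [Fact (0 < c₁)]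
  (U : Bond d (towerP L m (n + 1)) → 𝔸ˣ) (hL : 1 ≤ L) (α : ℕ → ℝ) (hα0 : ∀ j, 0 ≤ α j) (hα1 : ∀ j, α j ≤ 1 / 64)
  (hU1 : ∀ (j : ℕ) (x : B7Prop1Explicit.Site d) (κ : Fin d), perCfg (towerP L m (j + 1)) (UlevOf L m (n + 1) U j) x κ ∈ U1 𝔸)
  (hreg : ∀ (j : ℕ) (y : TSite d (towerP L m j)) (κ : Fin d) (r : Fin d → Fin L),
    ‖((Wcx L (perCfg (towerP L m (j + 1)) (UlevOf L m (n + 1) U j)) (cornerSite L y) κ (boxVec L r) : 𝔸ˣ) : 𝔸) - 1‖ ≤ α j)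
  (εU : ℕ → ℝ) (hεU : ∀ j, 0 ≤ εU j) (hUε : ∀ (j : ℕ) (b : Bond d (towerP L m (j + 1))), ‖(UlevOf L m (n + 1) U j b : 𝔸) - 1‖ ≤ εU j)
  {r εs : ℝ} (hr0 : 0 ≤ r) (hr1 : r < 1) (hεs : 0 ≤ εs) (hεg : ∀ j < n + 1, εU j ≤ εs * r ^ j)
  {Mφ Mφ' : ℝ} (hMφ : 0 ≤ Mφ) (hφ : ∀ w, ‖φ w‖ ≤ Mφ * ‖w‖) (hMφ' : 0 ≤ Mφ') (hφ' : ∀ X, ‖φ.symm X‖ ≤ Mφ' * ‖X‖)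

include hα0 hεU hUε hr0 hr1 hεs hεg hφ hMφ' hφ' in
omit [Fact (0 < c₀)] [Fact (0 < c₁)] in
/-- **THE TWO-BACKGROUND SPIKE LETTER `k_Δ` ON THE CARRIERS**: under the profiles, at EVERY unit-lattice bond `c` and every height,
`‖(Q_k(U)δ_b^u)(c) − (Q_k(1)δ_b^u)(c)‖ ≤ M_φ′·[L^d·2d·102(d+1)²L·(ε⋆∕(1−r))·((L^{n+1})^d)⁻¹e^{100d(d+1)L^dA}]·M_φ·‖u‖` — §3 read along the fibre map (`φ∘δ_b^u = δ_b^{φu}`).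
[folklore] [cite: Balaban1985BackgroundPropagators, (3.15)–(3.16) p.393, (3.78)–(3.79) p.406; Balaban1985Averaging, (124)–(127) pp.36–37] -/
theorem norm_QkW_sub_flat_single_le [DecidableEq (Bond d (towerP L m (n + 1)))] {A : ℝ} (hA : ∑ j ∈ Finset.range (n + 1), α j ≤ A)
    (b : Bond d (towerP L m (n + 1))) (u : W) (c : Bond d m) :
    ‖WL2.equiv ℂ (fun _ : Bond d m => c₁) W (QkW L m n φ U hL α hα1 hU1 hreg (c₀ := c₀) (c₁ := c₁)
          ((WL2.equiv ℂ (fun _ : Bond d (towerP L m (n + 1)) => c₀) W).symm (Pi.single b u))) c -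
        WL2.equiv ℂ (fun _ : Bond d m => c₁) W (QkW L m n φ (fun _ : Bond d (towerP L m (n + 1)) => (1 : 𝔸ˣ)) hL (fun _ => 0) (fun _ => by norm_num)
          (perCfg_UlevOf_one_mem_U1 L m (n + 1)) (norm_Wcx_UlevOf_one_sub_one_le L m (n + 1) (fun _ => 0) (fun _ => le_rfl)) (c₀ := c₀) (c₁ := c₁)
          ((WL2.equiv ℂ (fun _ : Bond d (towerP L m (n + 1)) => c₀) W).symm (Pi.single b u))) c‖ ≤
      Mφ' * ((L : ℝ) ^ d * (2 * d * (102 * (d + 1) ^ 2 * L)) * (εs / (1 - r)) *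
        ((((L : ℝ) ^ (n + 1)) ^ d)⁻¹ * Real.exp (100 * d * (d + 1) * (L : ℝ) ^ d * A))) * Mφ * ‖u‖ := by
  have hLpos : (0 : ℝ) < L := by exact_mod_cast hL
  have h1r : 0 < 1 - r := by linarith
  rw [equiv_QkW_apply, equiv_QkW_apply, comp_single_eq, ← map_sub]
  refine (hφ' _).trans ?_
  rw [mul_assoc, mul_assoc]
  refine mul_le_mul_of_nonneg_left ?_ hMφ'
  calc _ ≤ (L : ℝ) ^ d * (2 * d * (102 * (d + 1) ^ 2 * L)) * (εs / (1 - r)) *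
        ((((L : ℝ) ^ (n + 1)) ^ d)⁻¹ * Real.exp (100 * d * (d + 1) * (L : ℝ) ^ d * A)) * ‖φ u‖ :=
        norm_QkOfU_sub_flat_single_le_heightFree L m hL (n + 1) U α hα0 hα1 hU1 hreg εU hεU hUε hr0 hr1 hεs hεg hA b (φ u) c
    _ ≤ (L : ℝ) ^ d * (2 * d * (102 * (d + 1) ^ 2 * L)) * (εs / (1 - r)) *
        ((((L : ℝ) ^ (n + 1)) ^ d)⁻¹ * Real.exp (100 * d * (d + 1) * (L : ℝ) ^ d * A)) * (Mφ * ‖u‖) :=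
        mul_le_mul_of_nonneg_left (hφ u) (by positivity)
    _ = _ := by ring

variable [FiniteDimensional ℂ W]

include hα0 hεU hUε hr0 hr1 hεs hεg hMφ hφ hMφ' hφ' in
/-- **THE ADJOINT DIFFERENCE `Q_k(U)† − Q_k(1)†` POINTWISE FROM LOCAL DATA**: `‖h(c)‖ ≤ M` (`0 ≤ M`) at the unit-lattice bonds `c` with `Π(b₋) ∈ {c₋, c₋ + e_{c.2}}`
(at most `2d`, `card_near_le`) ⟹ `‖(Q_k(U)†h)(b) − (Q_k(1)†h)(b)‖ ≤ (c₁∕c₀)·k_Δ·2d·M`, `k_Δ` = §4's two-background spike letter — ne9-leaf-05's local duality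
`norm_adjoint_apply_le_local` at the DIFFERENCE map `Q_k(U) − Q_k(1)` (its spikes vanish off the zone at both backgrounds, `equiv_QkW_single_eq_zero`).  The letter of the
`(Q_k(U)† − Q_k(1)†)Q_k(1)` half of the penalty difference in [B9] (3.84)–(3.86). [folklore]
[cite: Balaban1985BackgroundPropagators, (3.16) p.393, (3.11) p.392, (3.78)–(3.79) p.406, (3.84)–(3.86) p.407; Balaban1985Averaging, p.24, (124)–(127) pp.36–37] -/
theorem norm_adjoint_QkW_sub_flat_apply_le_local [DecidableEq (Bond d (towerP L m (n + 1)))] {A : ℝ} (hA : ∑ j ∈ Finset.range (n + 1), α j ≤ A)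
    (h : BondL2K ℂ d m c₁ W) (b : Bond d (towerP L m (n + 1))) {M : ℝ} (hM : 0 ≤ M)
    (hh : ∀ c : Bond d m, (blockCoord (L ^ (n + 1)) m (siteCast (towerP_eq_fineP_pow L m (n + 1)) b.1) = c.1 ∨
        blockCoord (L ^ (n + 1)) m (siteCast (towerP_eq_fineP_pow L m (n + 1)) b.1) = shift c.2 c.1) →
      ‖WL2.equiv ℂ (fun _ : Bond d m => c₁) W h c‖ ≤ M) :
    ‖WL2.equiv ℂ (fun _ : Bond d (towerP L m (n + 1)) => c₀) W
          (LinearMap.adjoint (QkW L m n φ U hL α hα1 hU1 hreg (c₀ := c₀) (c₁ := c₁)) h) b -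
        WL2.equiv ℂ (fun _ : Bond d (towerP L m (n + 1)) => c₀) W
          (LinearMap.adjoint (QkW L m n φ (fun _ : Bond d (towerP L m (n + 1)) => (1 : 𝔸ˣ)) hL (fun _ => 0) (fun _ => by norm_num)
            (perCfg_UlevOf_one_mem_U1 L m (n + 1)) (norm_Wcx_UlevOf_one_sub_one_le L m (n + 1) (fun _ => 0) (fun _ => le_rfl))
            (c₀ := c₀) (c₁ := c₁)) h) b‖ ≤
      c₁ / c₀ * (Mφ' * ((L : ℝ) ^ d * (2 * d * (102 * (d + 1) ^ 2 * L)) * (εs / (1 - r)) *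
        ((((L : ℝ) ^ (n + 1)) ^ d)⁻¹ * Real.exp (100 * d * (d + 1) * (L : ℝ) ^ d * A))) * Mφ) * ((2 * d : ℕ) : ℝ) * M := by
  classical
  have hLpos : (0 : ℝ) < L := by exact_mod_cast hL
  have h1r : 0 < 1 - r := by linarith
  rw [← Pi.sub_apply, ← WL2.equiv_sub, ← LinearMap.sub_apply, ← map_sub]
  refine norm_adjoint_apply_le_local _ b
    (fun c : Bond d m => blockCoord (L ^ (n + 1)) m (siteCast (towerP_eq_fineP_pow L m (n + 1)) b.1) = c.1 ∨
      blockCoord (L ^ (n + 1)) m (siteCast (towerP_eq_fineP_pow L m (n + 1)) b.1) = shift c.2 c.1)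
    (by positivity) (card_near_le m _) (fun u c hc => ?_) (fun u c _ => ?_) h hM hh
  · simp only [not_or] at hc
    rw [LinearMap.sub_apply, WL2.equiv_sub, Pi.sub_apply,
      equiv_QkW_single_eq_zero L m n φ U hL α hα1 hU1 hreg b u c (Ne.symm hc.1) (Ne.symm hc.2),
      equiv_QkW_single_eq_zero L m n φ _ hL _ _ _ _ b u c (Ne.symm hc.1) (Ne.symm hc.2), sub_zero]
  · rw [LinearMap.sub_apply, WL2.equiv_sub, Pi.sub_apply]
    exact norm_QkW_sub_flat_single_le L m n φ U hL α hα0 hα1 hU1 hreg εU hεU hUε hr0 hr1 hεs hεg hφ hMφ' hφ' hA b u c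

include hα0 hεU hUε hr0 hr1 hεs hεg hMφ hφ hMφ' hφ' in
/-- **ON THE DIAGONAL `c₀(L^{n+1})^d = c₁` THE ADJOINT DIFFERENCE IS SMALL AND HEIGHT-FREE**: `‖(Q_k(U)†h)(b) − (Q_k(1)†h)(b)‖ ≤
M_φ′M_φ·L^d·2d·102(d+1)²L·(ε⋆∕(1−r))·e^{100d(d+1)L^dA}·2d·M` whenever `‖h(c)‖ ≤ M` on the zone of `b` — the carriers' `c₁∕c₀ = (L^{n+1})^d` is compensated by the
`L^{−(n+1)d}` of `k_Δ`; NO power of the height, LINEAR in the closeness profile `ε⋆`.  [folklore]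
[cite: Balaban1985BackgroundPropagators, (3.16) p.393, (3.35)–(3.37) p.396, (3.78)–(3.79) p.406, (3.84)–(3.86) p.407; Balaban1985Averaging, (124)–(127) pp.36–37] -/
theorem norm_adjoint_QkW_sub_flat_apply_le_local_diagonal [DecidableEq (Bond d (towerP L m (n + 1)))] {A : ℝ}
    (hA : ∑ j ∈ Finset.range (n + 1), α j ≤ A) (hw : c₀ * ((L : ℝ) ^ (n + 1)) ^ d = c₁)
    (h : BondL2K ℂ d m c₁ W) (b : Bond d (towerP L m (n + 1))) {M : ℝ} (hM : 0 ≤ M)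
    (hh : ∀ c : Bond d m, (blockCoord (L ^ (n + 1)) m (siteCast (towerP_eq_fineP_pow L m (n + 1)) b.1) = c.1 ∨
        blockCoord (L ^ (n + 1)) m (siteCast (towerP_eq_fineP_pow L m (n + 1)) b.1) = shift c.2 c.1) →
      ‖WL2.equiv ℂ (fun _ : Bond d m => c₁) W h c‖ ≤ M) :
    ‖WL2.equiv ℂ (fun _ : Bond d (towerP L m (n + 1)) => c₀) W
          (LinearMap.adjoint (QkW L m n φ U hL α hα1 hU1 hreg (c₀ := c₀) (c₁ := c₁)) h) b -
        WL2.equiv ℂ (fun _ : Bond d (towerP L m (n + 1)) => c₀) W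
          (LinearMap.adjoint (QkW L m n φ (fun _ : Bond d (towerP L m (n + 1)) => (1 : 𝔸ˣ)) hL (fun _ => 0) (fun _ => by norm_num)
            (perCfg_UlevOf_one_mem_U1 L m (n + 1)) (norm_Wcx_UlevOf_one_sub_one_le L m (n + 1) (fun _ => 0) (fun _ => le_rfl))
            (c₀ := c₀) (c₁ := c₁)) h) b‖ ≤
      Mφ' * Mφ * ((L : ℝ) ^ d * (2 * d * (102 * (d + 1) ^ 2 * L)) * (εs / (1 - r)) * Real.exp (100 * d * (d + 1) * (L : ℝ) ^ d * A)) *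
        ((2 * d : ℕ) : ℝ) * M := by
  have hc₀ : (0 : ℝ) < c₀ := (Fact.out : (0 : ℝ) < c₀)
  have hLd : (0 : ℝ) < ((L : ℝ) ^ (n + 1)) ^ d := by
    have : (0 : ℝ) < L := by exact_mod_cast hL
    positivity
  have h1 := norm_adjoint_QkW_sub_flat_apply_le_local (c₀ := c₀) (c₁ := c₁) L m n φ U hL α hα0 hα1 hU1 hreg εU hεU hUε hr0 hr1 hεs hεg hMφ hφ hMφ' hφ' hA h b hM hh
  have he : c₁ / c₀ * (Mφ' * ((L : ℝ) ^ d * (2 * d * (102 * (d + 1) ^ 2 * L)) * (εs / (1 - r)) *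
        ((((L : ℝ) ^ (n + 1)) ^ d)⁻¹ * Real.exp (100 * d * (d + 1) * (L : ℝ) ^ d * A))) * Mφ) =
      Mφ' * Mφ * ((L : ℝ) ^ d * (2 * d * (102 * (d + 1) ^ 2 * L)) * (εs / (1 - r)) * Real.exp (100 * d * (d + 1) * (L : ℝ) ^ d * A)) := by
    rw [← hw]; field_simp
  rw [he] at h1
  exact h1

end Carrier

end Literature.MathematicalPhysics.QuantumFieldTheory.Balaban1983to89.B9Eq315QkSingleBondTwoBackgroundLetter

end
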